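import Literature.Probability.LatticeModels.RandomClusterEdgeWeightsHomogeneous
import Literature.Probability.LatticeModels.RandomClusterDomainToBox
import HarnessLib

/-!
# FK-continuity transplant, FT-05 (v): the edge-parameter random-cluster law along an embedding of vertex types —
# support invariance ("idle vertices do not matter") for `rcMeasureW`

Cell `fk-continuity` (bschramm), FRONTIER TRANSPLANT sub-cell, registry row FT-05 (`KNFreePinning`, part v: the FK
replacement of `restrW` — restriction / change of the finite carrier); support file
(`--supports stmt-CriticalPhenomena-4575`); builds on p205010 (kernel theorem, internal audit signed; external
expert review pending). HONEST FRAMING: the transplant `ufsc0_of_freeBoundaryHypothesis_r0` this file serves is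
CONDITIONAL on the free-boundary penetration hypothesis FH (open at the same `p` for `q > 1`; ⇔ GRC Conj. (5.103)
via the referee's calibration K1; barrier note `SamePFreeBoundaryCriteria`, Literature/Barriers/CriticalPhenomena);
it is a typed reduction, not a proof of FK continuity. THIS file is unconditional finite-volume measure theory:
no named facts, no sorries, standard axioms; nothing here is specific to `q = 2` or to `d = 3`.

## What is here

The transplant's one law `fkLaw Λ W q` (FT-01 `FreeBoundaryHypotheses.lean`) is the edge-parameter random-cluster
measure `rcMeasureW` (Grimmett 2006, eq. (1.20)) of the finite piece `Λ ⊆ ℤ^d`, read on `ℤ^d`. The same weighting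
`W`, supported on the pairs inside `Λ`, can be read on any larger piece `Λ' ⊇ Λ`: the extra vertices are idle
(all their pairs have parameter `0`), and the two laws agree — SUPPORT INVARIANCE, needed whenever a look declared
on one piece is used inside a larger one (fkt-p4's ask (3), KN Theorem 6 Step IV: declaration-time `Sx h e du`
versus use-time arena; and the launch bound `KNFreeLaunchBound`: the free look lives on `v + ℓQ`, the environment
on `Sfin ⊇ v + ℓQ`). This file proves the finite-vertex-type statement behind it, for an arbitrary injection
`j : V ↪ U` of finite vertex types and parameters `w'` on `Sym2 U` that VANISH OFF THE RANGE of `Sym2.map j`: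

* `weight_image_sym2Map` — the product weight of the image configuration `j(ω)` under `w'` is the product weight
  of `ω` under `w' ∘ Sym2.map j` (the idle pairs contribute factors `1 - 0`);
* `rcWeightW_image_sym2Map` — `w^{j B}_{w',q}(j ω) = q^{#idle vertices} · w^B_{w'∘j,q}(ω)` (cluster counts:
  `card_connectedComponent_image_eq_add`, `RandomClusterDomainToBox.lean`);
* `rcWeightW_eq_zero_of_not_subset_range` — a configuration of `U` with a pair off the range has weight `0`;
* `rcPartitionFunctionW_eq_pow_mul` — `Z^{jB}_{w',q} = q^{#idle} · Z^B_{w'∘j,q}`;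
* `rcMeasureW_map_image_sym2Map` — **`(φ^B_{w'∘j,q}).map (ω ↦ j ω) = φ^{jB}_{w',q}`** (`0 < q`), and the applied
  form `rcMeasureW_real_preimage_image_sym2Map`: `φ^{jB}_{w',q}(A) = φ^B_{w'∘j,q}({ω | j ω ∈ A})`.

The homogeneous special case (`rcMeasure` of a graph whose edges are the image edges) is the tree's
`rcMeasure_real_map_image` (`RandomClusterEmbedding.lean`); here the parameters are arbitrary on the range, which is
what the weightings of the transplant (lattice `p`, revealed-open `1`, deleted `0`) require.

## References

* G. Grimmett, *The Random-Cluster Model*, Springer 2006: §1.4 eq. (1.20) (p. 15); §4.2, Lemma (4.13) (the measure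
  of a region seen inside a larger one). [Grimmett2006]
* G. Kozma, S. Nitzan, arXiv:2401.12397 (2024), §4 p. 24 ("in the subgraph `A`"), pp. 27–30. [KozmaNitzan2024]
-/

noncomputable section

open MeasureTheory Finset SimpleGraph
open scoped ENNReal Classical

namespace Summit.CriticalPhenomena.PercolationContinuityZ3.Theorems.FK

open Literature.Probability.Percolation (BondConfig openGraph)
open Literature.Probability.LatticeModels
open Literature.Probability.Percolation.BHK2006 (weight weight_nonneg)

section Embedding

variable {V U : Type*} (j : V ↪ U)

/-- The image of a configuration along `j`: `ω ↦ j(ω) = Sym2.map j '' ω`. Injective. [folklore] -/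
theorem image_sym2Map_injective : Function.Injective fun ω : BondConfig V => Sym2.map j '' ω :=
  Set.image_injective.2 (Sym2.map.injective j.injective)

/-- A pair of `U` in an image configuration lies in the range of `Sym2.map j`. [folklore] -/
theorem mem_range_of_mem_image {ω : BondConfig V} {e : Sym2 U} (he : e ∈ Sym2.map j '' ω) :
    e ∈ Set.range (Sym2.map j) := by
  obtain ⟨e₀, _, rfl⟩ := he
  exact ⟨e₀, rfl⟩

/-- Membership of an image pair in an image configuration. [folklore] -/
theorem map_mem_image_iff (ω : BondConfig V) (e : Sym2 V) : Sym2.map j e ∈ Sym2.map j '' ω ↔ e ∈ ω :=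
  (Sym2.map.injective j.injective).mem_set_image

/-- A configuration of `U` inside the range of `Sym2.map j` is an image configuration. [folklore] -/
theorem eq_image_preimage_of_subset_range {S : BondConfig U} (hS : S ⊆ Set.range (Sym2.map j)) :
    S = Sym2.map j '' (Sym2.map j ⁻¹' S) := by
  rw [Set.image_preimage_eq_inter_range, Set.inter_eq_left.2 hS]

variable [Fintype V] [Fintype U] (w' : Sym2 U → unitInterval) (hw' : ∀ e : Sym2 U, e ∉ Set.range (Sym2.map j) → w' e = 0)
include hw'

/-- **Product weights along an embedding**: if the parameters vanish off the range of `Sym2.map j`, the product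
weight of `j(ω)` is the product weight of `ω` for the pulled-back parameters (idle pairs contribute `1 - 0`).
[cite: Grimmett2006, §1.4 eq. (1.20) (p. 15)] -/
theorem weight_image_sym2Map (ω : BondConfig V) :
    weight (fun e => (w' e : ℝ)) (Sym2.map j '' ω) = weight (fun e => (w' (Sym2.map j e) : ℝ)) ω := by
  unfold weight
  -- the factors off the range are `1`
  have h1 : ∏ e ∈ (Finset.univ : Finset (Sym2 V)).map j.sym2Map,
      (if e ∈ Sym2.map j '' ω then (w' e : ℝ) else 1 - w' e) =
      ∏ e, (if e ∈ Sym2.map j '' ω then (w' e : ℝ) else 1 - w' e) := by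
    refine Finset.prod_subset (Finset.subset_univ _) fun e _ he => ?_
    have hrange : e ∉ Set.range (Sym2.map j) := by
      rintro ⟨e₀, rfl⟩
      exact he (Finset.mem_map.2 ⟨e₀, Finset.mem_univ _, rfl⟩)
    rw [if_neg (fun h => hrange (mem_range_of_mem_image j h)), hw' e hrange]
    simp
  rw [← h1, Finset.prod_map]
  refine Finset.prod_congr rfl fun e _ => ?_
  rw [Function.Embedding.sym2Map_apply, map_mem_image_iff]

/-- **Random-cluster weights along an embedding**: `w^{jB}_{w',q}(j ω) = q^{#(U ∖ j V)} · w^B_{w'∘j,q}(ω)` — the idle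
vertices are isolated clusters (`card_connectedComponent_image_eq_add`). [cite: Grimmett2006, §1.4 eq. (1.20) (p. 15); §4.2] -/
theorem rcWeightW_image_sym2Map (q : ℝ) (B : Set V) (ω : BondConfig V) :
    rcWeightW w' q (j '' B) (Sym2.map j '' ω) =
      q ^ Nat.card {u : U // u ∉ Set.range j} * rcWeightW (fun e => w' (Sym2.map j e)) q B ω := by
  unfold rcWeightW clusterCount
  rw [weight_image_sym2Map j w' hw' ω]
  have hk := card_connectedComponent_image_eq_add j ω B
  simp only [wiredOpenGraph] at hk
  rw [hk, pow_add]
  ring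

omit [Fintype V] in
/-- A configuration of `U` containing a pair off the range of `Sym2.map j` has weight `0` (that pair has parameter
`0` and is open). [cite: Grimmett2006, §1.4 eq. (1.20) (p. 15)] -/
theorem rcWeightW_eq_zero_of_not_subset_range (q : ℝ) (B' : Set U) {S : BondConfig U}
    (hS : ¬ S ⊆ Set.range (Sym2.map j)) : rcWeightW w' q B' S = 0 := by
  obtain ⟨e, heS, he⟩ := Set.not_subset.1 hS
  unfold rcWeightW weight
  rw [Finset.prod_eq_zero (Finset.mem_univ e) (by rw [if_pos heS]; simp [hw' e he]), zero_mul]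

/-- **Partition functions along an embedding**: `Z^{jB}_{w',q} = q^{#(U ∖ j V)} · Z^B_{w'∘j,q}`.
[cite: Grimmett2006, §1.4 eq. (1.20) (p. 15)] -/
theorem rcPartitionFunctionW_eq_pow_mul (q : ℝ) (B : Set V) :
    rcPartitionFunctionW w' q (j '' B) =
      q ^ Nat.card {u : U // u ∉ Set.range j} * rcPartitionFunctionW (fun e => w' (Sym2.map j e)) q B := by
  unfold rcPartitionFunctionW
  -- only image configurations contribute
  have h1 : ∑ S ∈ (Finset.univ : Finset (BondConfig V)).image (fun ω => Sym2.map j '' ω),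
      rcWeightW w' q (j '' B) S = ∑ S, rcWeightW w' q (j '' B) S := by
    refine Finset.sum_subset (Finset.subset_univ _) fun S _ hS => ?_
    refine rcWeightW_eq_zero_of_not_subset_range j w' hw' q (j '' B) fun hsub => hS ?_
    exact Finset.mem_image.2 ⟨Sym2.map j ⁻¹' S, Finset.mem_univ _, (eq_image_preimage_of_subset_range j hsub).symm⟩
  rw [← h1, Finset.sum_image fun ω₁ _ ω₂ _ h => image_sym2Map_injective j h, Finset.mul_sum]
  exact Finset.sum_congr rfl fun ω _ => rcWeightW_image_sym2Map j w' hw' q B ω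

/-- **The edge-parameter random-cluster law along an embedding** ("idle vertices do not matter"): for `0 < q`,
`(φ^B_{w'∘j,q}).map (ω ↦ j ω) = φ^{jB}_{w',q}` whenever the parameters `w'` vanish off the range of `Sym2.map j`
(Grimmett 2006, Lemma (4.13): the measure of a region seen inside a larger region whose extra edges are absent).
[cite: Grimmett2006, Lemma (4.13) (p. 71); §1.4 eq. (1.20)] -/
theorem rcMeasureW_map_image_sym2Map {q : ℝ} (hq : 0 < q) (B : Set V) :
    (rcMeasureW (fun e => w' (Sym2.map j e)) q B).map (fun ω : BondConfig V => Sym2.map j '' ω) =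
      rcMeasureW w' q (j '' B) := by
  set w : Sym2 V → unitInterval := fun e => w' (Sym2.map j e) with hw
  have hmeas : Measurable fun ω : BondConfig V => Sym2.map j '' ω := Measurable.of_discrete
  haveI := isProbabilityMeasure_rcMeasureW w hq B
  haveI := isProbabilityMeasure_rcMeasureW w' hq (j '' B)
  haveI : IsProbabilityMeasure ((rcMeasureW w q B).map fun ω : BondConfig V => Sym2.map j '' ω) :=
    Measure.isProbabilityMeasure_map hmeas.aemeasurable
  have hc : q ^ Nat.card {u : U // u ∉ Set.range j} ≠ 0 := pow_ne_zero _ hq.ne'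
  have hZ := rcPartitionFunctionW_pos w hq B
  refine Measure.ext_of_singleton fun S => ?_
  rw [Measure.map_apply hmeas (measurableSet_singleton S), ← ofReal_measureReal (measure_ne_top _ _),
    ← ofReal_measureReal (measure_ne_top _ _)]
  congr 1
  rw [rcMeasureW_real_singleton w' hq (j '' B) S, rcPartitionFunctionW_eq_pow_mul j w' hw' q B]
  by_cases hS : S ⊆ Set.range (Sym2.map j)
  · -- `S = j ω₀`: the preimage of `{S}` is `{ω₀}`
    set ω₀ : BondConfig V := Sym2.map j ⁻¹' S with hω₀
    have hSω₀ : S = Sym2.map j '' ω₀ := eq_image_preimage_of_subset_range j hS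
    have hpre : (fun ω : BondConfig V => Sym2.map j '' ω) ⁻¹' {S} = {ω₀} := by
      ext ω
      simp only [Set.mem_preimage, Set.mem_singleton_iff]
      constructor
      · intro h; exact image_sym2Map_injective j (h.trans hSω₀)
      · intro h; rw [h, hSω₀]
    rw [hpre, rcMeasureW_real_singleton w hq B ω₀, hSω₀, rcWeightW_image_sym2Map j w' hw' q B ω₀,
      mul_div_mul_left _ _ hc]
  · -- off the range: both sides vanish
    have hpre : (fun ω : BondConfig V => Sym2.map j '' ω) ⁻¹' {S} = ∅ := by
      ext ω
      simp only [Set.mem_preimage, Set.mem_singleton_iff, Set.mem_empty_iff_false, iff_false]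
      intro h
      exact hS (h ▸ fun e he => mem_range_of_mem_image j he)
    rw [hpre, measureReal_empty, rcWeightW_eq_zero_of_not_subset_range j w' hw' q (j '' B) hS, zero_div]

/-- Applied form: `φ^{jB}_{w',q}(A) = φ^B_{w'∘j,q}({ω | j ω ∈ A})` for every event `A` (`0 < q`).
[cite: Grimmett2006, Lemma (4.13) (p. 71); §1.4 eq. (1.20)] -/
theorem rcMeasureW_real_preimage_image_sym2Map {q : ℝ} (hq : 0 < q) (B : Set V) (A : Set (BondConfig U)) :
    (rcMeasureW (fun e => w' (Sym2.map j e)) q B).real {ω | Sym2.map j '' ω ∈ A} =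
      (rcMeasureW w' q (j '' B)).real A := by
  rw [← rcMeasureW_map_image_sym2Map j w' hw' hq B, measureReal_def, measureReal_def,
    Measure.map_apply Measurable.of_discrete (Set.toFinite A).measurableSet]
  rfl

end Embedding

end Summit.CriticalPhenomena.PercolationContinuityZ3.Theorems.FK

end
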